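import Summits.BirchSwinnertonDyer.Rank1Residual.Additive.X3BranchThreeLineCertificateCharactersTwo
import Literature.NumberTheory.GaloisRepresentations.DirichletCharacterOfGaloisCharacter
import HarnessLib

/-!
# X3 certificate road at `p = 3`: the line certificate with its characters for a GENERAL quadratic
# kernel character — radicals with quadratic Galois action (`√−1 ↔ χ₄`, products), and the packaging
# theorem `exists_lineDatum_three_characters_of_cert_quadratic` (cell `bsd-eis`, seat `bsd-eis-x3`
# gen 5; THEOREMS ONLY, nothing booked)

HONEST FRAMING (FULL-BSD rank-`≤ 1` programme D-0033, `run/shared/lean/pub/bsd-eis/README.md` §4;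
excluded-domain X3 = additive reducible, row B2 `r = 0`, (M), NON-degenerate). A TOOL for the per-pair
displays `X3CertificateDisplay<label>.lean` on the kernel discriminants NOT covered by the prime
(`q ≡ 1 (mod 4)`, gen 3) and `D = 2` (gen 5) packagings: `q ≡ 3 (mod 4)` (98 classes) and composite
`D` (116 classes) of the `1 094` (M) non-degenerate parity-OK rank-`0` classes at `p = 3`. The input of
the tree's general quadratic Kronecker–Weber lemma `X3Branch.smul_eq_quadraticCharacter_of_kernel_sqrt`
is a RADICAL `g` (`g² = D`) on which `Γ_ℚ` acts through a quadratic `ℤ`-valued character `χ` modulo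
`N` composed with `χ_N`; this file manufactures such radicals (the fourth root of unity for `χ₄`; the
tree has `√2 ↔ χ₈` and the Gauss sums `√q* ↔ (·/q)`) and multiplies them (`χ₁χ₂` at a common level),
and then packages the line datum with `φ = χ` read in `𝔽₃` and `ψ = ω₃·φ⁻¹` exactly as the prime case.

* `Rat.exists_sqrt_neg_one_smul_eq_chi4` — `ζ₄` with `τ • ζ₄ = χ₄(χ_4(τ))·ζ₄`;
* `Rat.smul_mul_eq_changeLevel_mul` — radicals multiply, characters multiply at a common level
  (`cast_modNCyclotomicCharacter`);
* `MulChar.IsQuadratic.changeLevel_int`, `MulChar.IsQuadratic.mul_int`, `DirichletCharacter.ringHomComp_changeLevel`;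
* `chi4_three_isPrimitive` — `χ₄` read in `𝔽₃` has conductor `4`;
* `exists_lineDatum_three_characters_of_cert_quadratic` — the packaging theorem.

References: [GreenbergVatsal2000] §2 p. 28 (the line `Φ`, `φψ = ω`); [Washington1997] Ch. 2–3
(Dirichlet characters as Galois characters, conductors); [IrelandRosen1990] Ch. 6 (Gauss sums).
-/

set_option autoImplicit false

noncomputable section

open scoped Classical NumberField

namespace Summit.BirchSwinnertonDyer.Rank1Residual.Additive

open WeierstrassCurve Polynomial NumberField IsDedekindDomain Field DirichletCharacter
  Literature.NumberTheory.GaloisRepresentations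
  Literature.NumberTheory.EllipticCurves
  Literature.NumberTheory.EllipticCurves.Rank1Residual
  Summit.BirchSwinnertonDyer.Rank1Residual.GaloisImage.RamifiedOrdinaryLineTwist

/-! ### §1 Radicals with quadratic Galois action -/

/-- **`√−1 = ζ₄` and `τ(ζ₄) = χ₄(χ_4(τ))·ζ₄`** (`ℚ(i) = ℚ(ζ₄)`; `τζ₄ = ζ₄^{χ_4(τ)} = ±ζ₄`).
[cite: Washington1997, Ch. 2 (cyclotomic fields; ℚ(ζ₄) = ℚ(i))] -/
theorem Rat.exists_sqrt_neg_one_smul_eq_chi4 :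
    ∃ s : AlgebraicClosure ℚ, s ≠ 0 ∧ s ^ 2 = -1 ∧
      ∀ τ : absoluteGaloisGroup ℚ,
        τ • s = ((ZMod.χ₄ (modNCyclotomicCharacter ℚ 4 τ : ZMod 4) : ℤ) : AlgebraicClosure ℚ) * s := by
  obtain ⟨ζ, hζ⟩ := HasEnoughRootsOfUnity.exists_primitiveRoot (AlgebraicClosure ℚ) 4
  have hζ4 : ζ ^ 4 = 1 := hζ.pow_eq_one
  have hζ2 : ζ ^ 2 = -1 := by
    have h2 : ζ ^ 2 ≠ 1 := hζ.pow_ne_one_of_pos_of_lt (by norm_num) (by norm_num)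
    have hsq : ζ ^ 2 * ζ ^ 2 = 1 := by rw [← pow_add]; exact hζ4
    rcases mul_self_eq_one_iff.mp hsq with h | h
    · exact absurd h h2
    · exact h
  refine ⟨ζ, hζ.ne_zero (by norm_num), hζ2, fun τ ↦ ?_⟩
  have hc := modNCyclotomicCharacter_spec ℚ 4 τ ζ hζ4
  have hu : ∀ u : (ZMod 4)ˣ, (u : ZMod 4) = 1 ∨ (u : ZMod 4) = 3 := by decide
  rcases hu (modNCyclotomicCharacter ℚ 4 τ) with h | h
  · rw [hc, h]
    have h1 : (ZMod.χ₄ (1 : ZMod 4) : ℤ) = 1 := by decide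
    rw [h1, show (1 : ZMod 4).val = 1 by decide, pow_one, Int.cast_one, one_mul]
  · rw [hc, h]
    have h3 : (ZMod.χ₄ (3 : ZMod 4) : ℤ) = -1 := by decide
    rw [h3, show (3 : ZMod 4).val = 3 by decide, Int.cast_neg, Int.cast_one, neg_one_mul]
    calc ζ ^ 3 = ζ ^ 2 * ζ := by ring
      _ = -ζ := by rw [hζ2]; ring

/-- **Radicals multiply**: if `τ•s₁ = χ₁(χ_{N₁}τ)·s₁` and `τ•s₂ = χ₂(χ_{N₂}τ)·s₂` then
`τ•(s₁s₂) = (χ₁χ₂)(χ_N τ)·(s₁s₂)` with `χ₁χ₂` the product at any common level `N`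
(`χ_N ≡ χ_{N_i} (mod N_i)`, `cast_modNCyclotomicCharacter`). [cite: Washington1997, Ch. 3 (Dirichlet characters as Galois characters)] -/
theorem Rat.smul_mul_eq_changeLevel_mul {N₁ N₂ N : ℕ} [NeZero N₁] [NeZero N₂] [NeZero N]
    (h₁ : N₁ ∣ N) (h₂ : N₂ ∣ N) (χ₁ : MulChar (ZMod N₁) ℤ) (χ₂ : MulChar (ZMod N₂) ℤ)
    {s₁ s₂ : AlgebraicClosure ℚ}
    (hs₁ : ∀ τ : absoluteGaloisGroup ℚ,
      τ • s₁ = ((χ₁ (modNCyclotomicCharacter ℚ N₁ τ : ZMod N₁) : ℤ) : AlgebraicClosure ℚ) * s₁)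
    (hs₂ : ∀ τ : absoluteGaloisGroup ℚ,
      τ • s₂ = ((χ₂ (modNCyclotomicCharacter ℚ N₂ τ : ZMod N₂) : ℤ) : AlgebraicClosure ℚ) * s₂)
    (τ : absoluteGaloisGroup ℚ) :
    τ • (s₁ * s₂) = (((changeLevel h₁ χ₁ * changeLevel h₂ χ₂ : MulChar (ZMod N) ℤ)
        (modNCyclotomicCharacter ℚ N τ : ZMod N) : ℤ) : AlgebraicClosure ℚ) * (s₁ * s₂) := by
  rw [smul_mul', hs₁ τ, hs₂ τ, MulChar.mul_apply, changeLevel_eq_cast_of_dvd χ₁ h₁,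
    changeLevel_eq_cast_of_dvd χ₂ h₂, cast_modNCyclotomicCharacter ℚ h₁, cast_modNCyclotomicCharacter ℚ h₂]
  push_cast
  ring

/-- Raising the level preserves quadraticity (values in `{0, ±1}`). [folklore] -/
theorem MulChar.IsQuadratic.changeLevel_int {N₁ N : ℕ} [NeZero N] {χ : MulChar (ZMod N₁) ℤ}
    (hχ : χ.IsQuadratic) (h : N₁ ∣ N) : (changeLevel h χ).IsQuadratic := by
  intro a
  by_cases ha : IsUnit a
  · obtain ⟨u, rfl⟩ := ha
    rw [changeLevel_eq_cast_of_dvd χ h]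
    exact hχ _
  · exact Or.inl (MulChar.map_nonunit _ ha)

/-- Products of quadratic `ℤ`-valued characters are quadratic. [folklore] -/
theorem MulChar.IsQuadratic.mul_int {R : Type*} [CommMonoid R] {χ χ' : MulChar R ℤ}
    (hχ : χ.IsQuadratic) (hχ' : χ'.IsQuadratic) : (χ * χ').IsQuadratic := by
  intro a
  rw [MulChar.mul_apply]
  rcases hχ a with h | h | h <;> rcases hχ' a with h' | h' | h' <;> simp [h, h']

/-- `ringHomComp` commutes with `changeLevel`. [folklore] -/
theorem DirichletCharacter.ringHomComp_changeLevel {R R' : Type*} [CommRing R] [CommRing R']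
    {N₁ N : ℕ} [NeZero N] (h : N₁ ∣ N) (χ : DirichletCharacter R N₁) (f : R →+* R') :
    (changeLevel h χ).ringHomComp f = changeLevel h (χ.ringHomComp f) := by
  ext u
  rw [MulChar.ringHomComp_apply, changeLevel_eq_cast_of_dvd χ h, changeLevel_eq_cast_of_dvd _ h,
    MulChar.ringHomComp_apply]

/-- **`χ₄` read in `𝔽₃` is PRIMITIVE** (conductor `4`): its conductor divides `4` but is neither `1` nor
`2`, since `3 ≡ 1 (mod 2)` while `χ₄(3) = −1 ≠ 1` in `𝔽₃`. [cite: Washington1997, Ch. 3 (conductors of Dirichlet characters)] -/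
theorem chi4_three_isPrimitive :
    DirichletCharacter.IsPrimitive
      (ZMod.χ₄.ringHomComp (Int.castRingHom (ZMod 3)) : DirichletCharacter (ZMod 3) 4) := by
  set χ : DirichletCharacter (ZMod 3) 4 := ZMod.χ₄.ringHomComp (Int.castRingHom (ZMod 3)) with hχdef
  have h3 : χ (3 : ℤ) = -1 := by
    rw [hχdef, MulChar.ringHomComp_apply]
    have h : ZMod.χ₄ ((3 : ℤ) : ZMod 4) = -1 := by decide
    rw [h]
    simp
  rw [DirichletCharacter.isPrimitive_def]
  have hdvd : χ.conductor ∣ 2 ^ 2 := χ.conductor_dvd_level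
  have hnot : ¬ χ.conductor ∣ 2 := by
    intro h2
    have hmem : 2 ∈ χ.conductorSet :=
      (χ.mem_conductorSet_iff_conductor_dvd (show 2 ∣ 4 by norm_num)).mpr h2
    obtain ⟨hd, χ₀, hχ₀⟩ := (χ.mem_conductorSet_iff.mp hmem)
    have hcop : IsCoprime (3 : ℤ) (4 : ℕ) := by
      rw [Int.isCoprime_iff_gcd_eq_one]; decide
    have h3' : χ (3 : ℤ) = χ₀ (3 : ℤ) := by
      rw [hχ₀, DirichletCharacter.changeLevel_eq_cast_of_dvd' χ₀ hd hcop]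
    have h31 : ((3 : ℤ) : ZMod 2) = 1 := by decide
    rw [h3, h31, map_one] at h3'
    exact absurd h3' (by decide)
  obtain ⟨k, hk, hk'⟩ := (Nat.dvd_prime_pow Nat.prime_two).mp hdvd
  interval_cases k
  · exact absurd (hk' ▸ one_dvd 2) hnot
  · exact absurd (hk' ▸ dvd_refl 2) hnot
  · rw [hk']; norm_num

/-! ### §2 The line datum with its two characters for a general quadratic kernel character -/

variable {W : WeierstrassCurve ℚ} [W.IsElliptic]

/-- **The line datum WITH ITS TWO CHARACTERS, general quadratic kernel character.** Data: a
certificate `Ψ₃(x₀) = 0`, `D·s² = Ψ₂Sq(x₀)` (`D` squarefree, `0 < D ≠ 1`, `3 ∤ D`, `s ≠ 0`); a quadratic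
`ℤ`-valued character `χ` modulo `N`, `3 ∤ N`, whose reduction `φ = χ mod 3` is PRIMITIVE of conductor
`N`; and a RADICAL `g ≠ 0`, `g² = D`, with `τ • g = χ(χ_N(τ))·g`. Conclusion: the rational `3`-line `Φ₀`
(even, non-trivial action, `χ_K`-twist ramified at `3`) on which `Γ_ℚ` acts through `φ`
(`X3Branch.smul_eq_quadraticCharacter_of_kernel_sqrt`), and `ψ = ω₃·φ⁻¹` PRIMITIVE of level `3N` on
`W[3]/Φ₀` — every LINE input of `X3Branch.eval_of_charFacts_of_characters`. [folklore] -/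
theorem exists_lineDatum_three_characters_of_cert_quadratic [hp : Fact (Nat.Prime 3)] {x₀ s : ℚ}
    {D : ℤ} {N : ℕ} [NeZero N] (χ : MulChar (ZMod N) ℤ) (hχ2 : χ.IsQuadratic)
    (hprim : DirichletCharacter.IsPrimitive
      (χ.ringHomComp (Int.castRingHom (ZMod 3)) : DirichletCharacter (ZMod 3) N))
    (h3N : ¬ 3 ∣ N) {g : AlgebraicClosure ℚ} (hg0 : g ≠ 0) (hg2 : g ^ 2 = ((D : ℚ) : AlgebraicClosure ℚ))
    (hgs : ∀ τ : absoluteGaloisGroup ℚ,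
      τ • g = ((χ (modNCyclotomicCharacter ℚ N τ : ZMod N) : ℤ) : AlgebraicClosure ℚ) * g)
    (hψ : W.Ψ₃.eval x₀ = 0) (hsq : Squarefree D) (hs : s ≠ 0)
    (hDs : (D : ℚ) * s ^ 2 = W.Ψ₂Sq.eval x₀) (hpos : 0 < D) (hD1 : D ≠ 1) (h3D : ¬ (3 : ℤ) ∣ D) :
    ∃ Φ₀ : AddSubgroup (geomTorsion W ((3 : ℕ) : ℤ)), IsRationalLine W 3 Φ₀ ∧ LineEven W 3 Φ₀ ∧
      (∃ (σ : absoluteGaloisGroup ℚ) (P : W.geomTorsion ((3 : ℕ) : ℤ)), P ∈ Φ₀ ∧ σ • P ≠ P) ∧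
      (∀ (K : Type) [Field K] [NumberField K] [(galRange (K := ℚ) K).Normal],
        Module.finrank ℚ K = 2 →
        (∃ θ : K, θ ^ 2 = algebraMap ℚ K ((-1) ^ ((3 : ℕ) / 2) * (3 : ℕ))) →
        ¬ ∀ v : HeightOneSpectrum (𝓞 ℚ), (((3 : ℕ) : ℕ) : 𝓞 ℚ) ∈ v.asIdeal →
          ∀ 𝔓 ∈ v.primesAbove, ∀ σ ∈ 𝔓.inertia (absoluteGaloisGroup ℚ), ∀ P ∈ Φ₀,
            σ • P = (if σ ∈ galRange (K := ℚ) K then P else -P)) ∧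
      DirichletCharacter.IsPrimitive
        (χ.ringHomComp (Int.castRingHom (ZMod 3)) : DirichletCharacter (ZMod 3) N) ∧
      (∀ (σ : absoluteGaloisGroup ℚ), ∀ P ∈ Φ₀,
        σ • P = ((χ.ringHomComp (Int.castRingHom (ZMod 3)) : DirichletCharacter (ZMod 3) N)
          ((modNCyclotomicCharacter ℚ N σ : (ZMod N)ˣ) : ZMod N)).val • P) ∧
      DirichletCharacter.IsPrimitive
        (changeLevel (dvd_mul_right 3 N) (MulChar.ofUnitHom (MonoidHom.id (ZMod 3)ˣ)) *
          changeLevel (dvd_mul_left N 3)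
            (χ.ringHomComp (Int.castRingHom (ZMod 3)) : DirichletCharacter (ZMod 3) N)⁻¹ :
          DirichletCharacter (ZMod 3) (3 * N)) ∧
      (∀ (σ : absoluteGaloisGroup ℚ) (P : W.geomTorsion ((3 : ℕ) : ℤ)),
        σ • P - ((changeLevel (dvd_mul_right 3 N) (MulChar.ofUnitHom (MonoidHom.id (ZMod 3)ˣ)) *
          changeLevel (dvd_mul_left N 3)
            (χ.ringHomComp (Int.castRingHom (ZMod 3)) : DirichletCharacter (ZMod 3) N)⁻¹ :
          DirichletCharacter (ZMod 3) (3 * N))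
          ((modNCyclotomicCharacter ℚ (3 * N) σ : (ZMod (3 * N))ˣ) : ZMod (3 * N))).val • P ∈ Φ₀) := by
  obtain ⟨Φ₀, hΦ, heven, hnt, hram, hχker⟩ :=
    exists_lineDatum_three_kernelField_of_cert' hψ hsq hs hDs hpos hD1 h3D
  -- `g = ± √D`, so `σ` fixes `Φ₀` pointwise iff it fixes `g`
  have hgs' : g = geomSqrt (D : ℚ) ∨ g = -geomSqrt (D : ℚ) := by
    have h : (g - geomSqrt (D : ℚ)) * (g + geomSqrt (D : ℚ)) = 0 := by
      have : g ^ 2 = geomSqrt (D : ℚ) ^ 2 := by rw [hg2, geomSqrt_sq, eq_ratCast]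
      linear_combination this
    rcases mul_eq_zero.mp h with h1 | h1
    · exact Or.inl (by linear_combination h1)
    · exact Or.inr (by linear_combination h1)
  have hker : ∀ σ : absoluteGaloisGroup ℚ, (∀ Q ∈ Φ₀, σ • Q = Q) ↔ σ • g = g := by
    intro σ
    rw [hχker σ]
    rcases hgs' with h | h
    · rw [h]
    · rw [h, smul_neg, neg_inj]
  have hφ0 : ∀ (σ : absoluteGaloisGroup ℚ), ∀ P ∈ Φ₀,
      σ • P = ((χ.ringHomComp (Int.castRingHom (ZMod 3)) : DirichletCharacter (ZMod 3) N)
        ((modNCyclotomicCharacter ℚ N σ : (ZMod N)ˣ) : ZMod N)).val • P :=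
    fun σ P hP ↦ X3Branch.smul_eq_quadraticCharacter_of_kernel_sqrt hΦ χ hχ2 hg0 hgs hker σ P hP
  exact ⟨Φ₀, hΦ, heven, hnt, hram, hprim, hφ0,
    X3Branch.quotCharacter_isPrimitive (p := 3) (by decide) _ hprim h3N,
    fun σ P ↦ X3Branch.smul_sub_quotCharacter_mem hΦ _ hφ0 σ P⟩

end Summit.BirchSwinnertonDyer.Rank1Residual.Additive

end
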